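/-
Copyright (c) 2026. All rights reserved.
Released under Apache 2.0 license as described in the file LICENSE.
-/
import Literature.NumberTheory.GaloisRepresentations.SerreWeightExistenceProofs
import Literature.NumberTheory.GaloisRepresentations.HerbrandFunction
import Literature.NumberTheory.GaloisRepresentations.RamificationFiltrationProofs
import Literature.NumberTheory.GaloisRepresentations.LocalGaloisGroupProofs
import Literature.NumberTheory.GaloisRepresentations.ContinuousH1
import Literature.NumberTheory.GaloisRepresentations.CoinducedModule
import HarnessLib

/-!
# `H¹` of the inertia group with finite coefficients of order prime to `p` is finite

Let `F` be a non-archimedean local field with residue characteristic `p`, `I_F ≤ Γ_F` its inertia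
group and `B` a finite discrete `Γ_F`-module of order prime to `p`. We prove
`#H¹(I_F, B) ≤ #B` (in particular `H¹(I_F, B)` is finite), the finiteness input of the proof of
`χ(Γ_F, B) = 1` (Harari, *Galois Cohomology and Class Field Theory*, Lemma 10.13; Milne,
*Arithmetic Duality Theorems*, I Lemma 2.9; Serre, *Cohomologie galoisienne*, II §5.5).

## The argument (finite quotients only)

A finite family of continuous cocycles `φ : I_F → B` is invariant under `I_F ∩ V` for an open
normal subgroup `V ⊴ Γ_F` acting trivially on `B`. The images of the upper ramification groups
`I_F^v`, `v > 0`, in the finite group `Γ_F/V` increase as `v ↓ 0` and stabilise at some `v₁ > 0`;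
the image of `I_F^{v₁}` is a `p`-group (`absUpperInertia_map_isPGroup_holds`), so the averaging
trick (`#P` is invertible on `B`) makes each `φ` a coboundary on `I_F^{v₁}`, hence equal to a
coboundary on `W = I_F ∩ I_F^{v₁} V`. The homomorphism `Γ_F → Γ_F / I_F^{v₁} V` kills every
`I_F^v`, `v > 0`, so the image of `I_F` — that is `I_F / W` — is cyclic
(`absInertia_map_isCyclic_holds`), and a cocycle vanishing on `W` is determined by its value at a
generator: `#B + 1` classes would give `#B + 1` distinct elements of `B`.

## Main results

* `exists_forall_eq_coboundary_of_isPGroup`: the averaging trick on a `p`-group quotient.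
* `exists_subgroup_forall_eq_coboundary`: the key step for a finite family of cocycles.
* `natCard_continuousCohomology_one_absInertia_le`: **`#H¹(I_F, B) ≤ #B`** and finiteness.
-/

noncomputable section

open CategoryTheory Function
open scoped Pointwise Valued
open Field ValuativeRel

universe u

namespace Literature.NumberTheory.GaloisRepresentations

open _root_.TopRep _root_.ContinuousCohomology _root_.Topology _root_.Filter
open GaloisRepresentations.IsNonarchimedeanLocalField

/-! ### Uniform local constancy on a compact group -/

section Uniform

variable {G : Type*} [Group G] [TopologicalSpace G] [IsTopologicalGroup G] [CompactSpace G]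

/-- A locally constant function on a compact group is invariant under right translation by a
neighbourhood of `1` (private copy of the folklore lemma of `TateProjectiveLiftingH2Proofs`).
[folklore] -/
private theorem exists_nhds_one_forall_mul_eq {Y : Type*} {f : G → Y} (hf : IsLocallyConstant f) :
    ∃ V ∈ 𝓝 (1 : G), ∀ g, ∀ v ∈ V, f (g * v) = f g := by
  classical
  have hfib : ∀ y : Y, ∃ V ∈ 𝓝 (1 : G), f ⁻¹' {y} * V ⊆ f ⁻¹' {y} := fun y =>
    compact_open_separated_mul_right (hf.isClosed_fiber y).isCompact (hf.isOpen_fiber y) subset_rfl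
  choose V hV hVsub using hfib
  have hfin : (Set.range f).Finite := hf.range_finite
  refine ⟨⋂ y ∈ hfin.toFinset, V y, (Filter.biInter_finset_mem _).2 fun y _ => hV y, fun g v hv => ?_⟩
  have hvy : v ∈ V (f g) := Set.mem_iInter₂.1 hv (f g) (by rw [Set.Finite.mem_toFinset]; exact ⟨g, rfl⟩)
  exact hVsub (f g) (Set.mul_mem_mul rfl hvy)

end Uniform

/-! ### The averaging trick -/

section Averaging

variable {Γ : Type u} [Group Γ] [TopologicalSpace Γ] [IsTopologicalGroup Γ]
variable {B : Type u} [AddCommGroup B] [TopologicalSpace B] [DiscreteTopology B]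

omit [IsTopologicalGroup Γ] [DiscreteTopology B] in
/-- **The averaging trick.** Let `J ≤ Γ` act on the finite module `B` through the finite `p`-group
`J V / V` (`V ⊴ Γ` acting trivially, `φ` right `V`-invariant on `J`) with `p ∤ #B`. Then every
crossed homomorphism `φ` on `J` is a coboundary on `J`: `#P · φ(x) = -(x - 1) Σ φ` and `#P` is
invertible on `B`. [cite: SerreLocalFields1979, VIII §2 Cor. 1 of Prop. 4] -/
theorem exists_forall_eq_coboundary_of_isPGroup [Finite B] (ρ : ContinuousRep Γ ℤ B) {p : ℕ} [Fact p.Prime]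
    (hB : (Nat.card B).Coprime p) (J V : Subgroup Γ) [V.Normal] [Finite (Γ ⧸ V)]
    (hP : IsPGroup p (J.map (QuotientGroup.mk' V)))
    (φ : J → B) (hφ : ∀ x y : J, φ (x * y) = φ x + ρ (x : Γ) (φ y))
    (hφV : ∀ (x y : J), ((y : Γ) : Γ ⧸ V) = 1 → φ (x * y) = φ x) :
    ∃ b : B, ∀ x : J, φ x = ρ (x : Γ) b - b := by
  classical
  set P : Subgroup (Γ ⧸ V) := J.map (QuotientGroup.mk' V) with hPdef
  haveI : Fintype P := Fintype.ofFinite P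
  -- representatives
  have hrep : ∀ q : P, ∃ y : J, (QuotientGroup.mk' V) (y : Γ) = q := fun q => by
    obtain ⟨y, hy, hyq⟩ := Subgroup.mem_map.1 q.2
    exact ⟨⟨y, hy⟩, hyq⟩
  choose rep hrep using hrep
  -- the class of an element of `J`
  let cl : J → P := fun y => ⟨QuotientGroup.mk' V (y : Γ), Subgroup.mem_map_of_mem _ y.2⟩
  -- `φ` is a function of the class
  have hwd : ∀ y : J, φ y = φ (rep (cl y)) := fun y => by
    have h1 : (QuotientGroup.mk' V) ((rep (cl y) : J) : Γ) = QuotientGroup.mk' V (y : Γ) := hrep (cl y)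
    have h2 : (((rep (cl y))⁻¹ * y : J) : Γ) ∈ V := by
      rw [QuotientGroup.mk'_apply, QuotientGroup.mk'_apply, QuotientGroup.eq] at h1
      exact h1
    have := hφV (rep (cl y)) ((rep (cl y))⁻¹ * y) ((QuotientGroup.eq_one_iff _).2 h2)
    rw [mul_inv_cancel_left] at this
    exact this
  let S : B := ∑ q : P, φ (rep q)
  have hsum : ∀ x : J, (Nat.card P) • φ x = -(ρ (x : Γ) S - S) := fun x => by
    have h1 : ∑ q : P, φ (x * rep q) = (Fintype.card P) • φ x + ρ (x : Γ) S := by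
      simp only [hφ, Finset.sum_add_distrib, Finset.sum_const, Finset.card_univ, map_sum, S]
    have h2 : ∑ q : P, φ (x * rep q) = S := by
      have h3 : ∀ q : P, φ (x * rep q) = φ (rep (cl x * q)) := fun q => by
        rw [hwd (x * rep q)]
        congr 2
        refine Subtype.ext ?_
        change QuotientGroup.mk' V ((x : Γ) * (rep q : Γ)) = QuotientGroup.mk' V (x : Γ) * (q : Γ ⧸ V)
        rw [map_mul, hrep q]
      simp_rw [h3]
      exact Fintype.sum_equiv (Equiv.mulLeft (cl x)) _ _ fun q => rfl
    rw [Nat.card_eq_fintype_card]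
    have := h1.symm.trans h2
    rw [← sub_eq_zero] at this ⊢
    rw [← this]; abel
  -- `#P = p^a` is invertible on `B`
  obtain ⟨a, ha⟩ := IsPGroup.iff_card.1 hP
  have hcop : (Nat.card B).Coprime (p ^ a) := hB.pow_right a
  let e : B ≃ B := nsmulCoprime hcop
  have he : ∀ b : B, e b = (p ^ a) • b := fun b => nsmulCoprime_apply hcop b
  refine ⟨-(e.symm S), fun x => e.injective ?_⟩
  have hS : Nat.card P • e.symm S = S := by rw [ha, ← he, e.apply_symm_apply]
  rw [he, he, ← ha, hsum, map_neg, smul_sub, smul_neg, smul_neg, ← map_nsmul, hS]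
  abel

end Averaging

/-! ### Cocycles vanishing on a cocyclic subgroup -/

section Cyclic

variable {I : Type u} [Group I]
variable {B : Type u} [AddCommGroup B]

/-- A crossed homomorphism vanishing on a subgroup `W` with `I = ⋃ g^k W` and vanishing at `g`
vanishes identically. [folklore] -/
theorem eq_zero_of_forall_mem_of_apply_eq_zero (σ : I → B → B) (hσ : ∀ x, σ x 0 = 0) (W : Subgroup I)
    (g : I) (hgen : ∀ x : I, ∃ k : ℕ, (g ^ k)⁻¹ * x ∈ W) (D : I → B)
    (hD : ∀ x y, D (x * y) = D x + σ x (D y)) (hW : ∀ w ∈ W, D w = 0) (hg : D g = 0) (x : I) :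
    D x = 0 := by
  have hpow : ∀ k : ℕ, D (g ^ k) = 0 := fun k => by
    induction k with
    | zero => rw [pow_zero]; exact hW 1 W.one_mem
    | succ k ih => rw [pow_succ', hD, hg, ih, hσ, zero_add]
  obtain ⟨k, hk⟩ := hgen x
  have := hD (g ^ k) ((g ^ k)⁻¹ * x)
  rw [mul_inv_cancel_left, hpow, hW _ hk, hσ, zero_add] at this
  exact this

end Cyclic

/-! ### The local statement -/

section Local

variable (F : Type u) [Field F] [ValuativeRel F] [TopologicalSpace F] [IsNonarchimedeanLocalField F]

variable {B : Type u} [AddCommGroup B] [TopologicalSpace B] [DiscreteTopology B] [Finite B]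

/-- **Key step.** For a finite family `s` of continuous crossed homomorphisms `I_F → B` there are
a subgroup `W ≤ I_F` with `I_F / W` cyclic (`I_F = ⋃ g^k W`) and, for each `φ ∈ s`, an element
`b ∈ B` with `φ = ∂b` on `W`. [cite: SerreLocalFields1979, IV §2 Cor. 1 and Cor. 3 of Prop. 7] -/
theorem exists_subgroup_forall_eq_coboundary (ρ : ContinuousRep (absoluteGaloisGroup F) ℤ B)
    (hB : (Nat.card B).Coprime (ringChar 𝓀[F]))
    (s : Finset (contOneCocycles ((ρ.restrict (subgroupIncl (absInertia F))).toTopRep))) :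
    ∃ (W : Subgroup (absInertia F)) (g : absInertia F),
      (∀ x : absInertia F, ∃ k : ℕ, (g ^ k)⁻¹ * x ∈ W) ∧
      ∀ φ ∈ s, ∃ b : B, ∀ w ∈ W, φ.1 w = ρ (w : absoluteGaloisGroup F) b - b := by
  classical
  haveI : CompactSpace (absoluteGaloisGroup F) := absoluteGaloisGroup_compactSpace F
  haveI : Fact (ringChar 𝓀[F]).Prime := ⟨ringChar_residueField_prime (F := F)⟩
  have hIcl : IsClosed (absInertia F : Set (absoluteGaloisGroup F)) := isClosed_absInertia_holds F
  haveI : CompactSpace (absInertia F) := isCompact_iff_compactSpace.mp hIcl.isCompact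
  -- Step 1: an open normal `V` acting trivially, with all `φ ∈ s` right `I ∩ V`-invariant
  obtain ⟨V, hVnormal, hVopen, hVact, hVinv⟩ : ∃ V : Subgroup (absoluteGaloisGroup F), V.Normal ∧
      IsOpen (V : Set (absoluteGaloisGroup F)) ∧ (∀ v ∈ V, ∀ b : B, ρ v b = b) ∧
      ∀ φ ∈ s, ∀ (x y : absInertia F), (y : absoluteGaloisGroup F) ∈ V → φ.1 (x * y) = φ.1 x := by
    haveI : Fintype B := Fintype.ofFinite B
    have hker : IsOpen {g : absoluteGaloisGroup F | ∀ b : B, ρ g b = b} := by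
      have : {g : absoluteGaloisGroup F | ∀ b : B, ρ g b = b} = ⋂ b : B, (fun g => ρ g b) ⁻¹' {b} := by
        ext g; simp
      rw [this]
      exact isOpen_iInter_of_finite fun b => (isOpen_discrete _).preimage (ρ.continuous_apply_left b)
    obtain ⟨V₁, hV₁⟩ := ProfiniteGrp.exist_openNormalSubgroup_sub_open_nhds_of_one hker
      (fun b => by rw [map_one]; rfl)
    -- uniform local constancy of the family on `I`
    let Φ : absInertia F → (s → B) := fun x φ =>
      (show C(absInertia F, B) from ((φ : contOneCocycles ((ρ.restrict (subgroupIncl (absInertia F))).toTopRep)).1)) x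
    have hΦ : IsLocallyConstant Φ :=
      (IsLocallyConstant.iff_continuous Φ).2 (continuous_pi fun φ =>
        (show C(absInertia F, B) from
          ((φ : contOneCocycles ((ρ.restrict (subgroupIncl (absInertia F))).toTopRep)).1)).continuous)
    obtain ⟨U, hU, hUΦ⟩ := exists_nhds_one_forall_mul_eq hΦ
    rw [nhds_subtype_eq_comap, Filter.mem_comap] at hU
    obtain ⟨U', hU', hU'U⟩ := hU
    obtain ⟨V₂, hV₂⟩ := ProfiniteGrp.exist_openNormalSubgroup_sub_open_nhds_of_one isOpen_interior
      (mem_interior_iff_mem_nhds.2 hU')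
    refine ⟨(V₁ : Subgroup (absoluteGaloisGroup F)) ⊓ (V₂ : Subgroup (absoluteGaloisGroup F)), inferInstance,
      V₁.isOpen.inter V₂.isOpen, fun v hv b => hV₁ hv.1 b, fun φ hφ x y hy => ?_⟩
    have hyU : y ∈ U := hU'U (show (y : absoluteGaloisGroup F) ∈ U' from interior_subset (hV₂ hy.2))
    exact congr_fun (hUΦ x y hyU) ⟨φ, hφ⟩
  haveI := hVnormal
  haveI : Finite (absoluteGaloisGroup F ⧸ V) := Subgroup.quotient_finite_of_isOpen V hVopen
  haveI : DiscreteTopology (absoluteGaloisGroup F ⧸ V) := QuotientGroup.discreteTopology hVopen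
  let π : absoluteGaloisGroup F →ₜ* (absoluteGaloisGroup F ⧸ V) := ⟨QuotientGroup.mk' V, QuotientGroup.continuous_mk⟩
  -- Step 2: the images of `I^v` in `Γ/V` stabilise near `0`
  let Pv : ℝ → Subgroup (absoluteGaloisGroup F ⧸ V) := fun v => (absUpperInertia F v).map π.toMonoidHom
  have hanti : ∀ {v v'}, v ≤ v' → Pv v' ≤ Pv v := fun h => Subgroup.map_mono (absUpperInertia_antitone_holds F h)
  obtain ⟨v₁, hv₁, hstab⟩ : ∃ v₁ : ℝ, 0 < v₁ ∧ ∀ v, 0 < v → v ≤ v₁ → Pv v = Pv v₁ := by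
    let a : ℕ →o Subgroup (absoluteGaloisGroup F ⧸ V) := ⟨fun n => Pv (1 / (n + 1)), fun m n hmn => hanti (by
      apply one_div_le_one_div_of_le (by positivity); exact_mod_cast Nat.succ_le_succ hmn)⟩
    obtain ⟨n₀, hn₀⟩ := WellFoundedGT.monotone_chain_condition a
    refine ⟨1 / (n₀ + 1), by positivity, fun v hv hle => le_antisymm ?_ (hanti hle)⟩
    obtain ⟨n, hn⟩ := exists_nat_one_div_lt hv
    have h1 : (1 : ℝ) / ((max n n₀ : ℕ) + 1) ≤ v := by
      refine le_trans ?_ hn.le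
      apply one_div_le_one_div_of_le (by positivity)
      exact_mod_cast Nat.succ_le_succ (le_max_left n n₀)
    calc Pv v ≤ Pv (1 / ((max n n₀ : ℕ) + 1)) := hanti h1
      _ = a (max n n₀) := rfl
      _ = a n₀ := (hn₀ _ (le_max_right _ _)).symm
      _ = Pv (1 / (n₀ + 1)) := rfl
  -- Step 3: `K = I^{v₁} V`, open normal, kills every `I^v`
  set J : Subgroup (absoluteGaloisGroup F) := absUpperInertia F v₁ with hJdef
  haveI : J.Normal := absUpperInertia_normal F v₁
  have hJI : J ≤ absInertia F := absUpperInertia_le_absInertia_holds F v₁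
  set K : Subgroup (absoluteGaloisGroup F) := J ⊔ V with hKdef
  haveI : K.Normal := Subgroup.sup_normal J V
  have hVK : V ≤ K := le_sup_right
  have hKopen : IsOpen (K : Set (absoluteGaloisGroup F)) := Subgroup.isOpen_mono hVK hVopen
  haveI : DiscreteTopology (absoluteGaloisGroup F ⧸ K) := QuotientGroup.discreteTopology hKopen
  haveI : Finite (absoluteGaloisGroup F ⧸ K) := Subgroup.quotient_finite_of_isOpen K hKopen
  let f : absoluteGaloisGroup F →ₜ* (absoluteGaloisGroup F ⧸ K) := ⟨QuotientGroup.mk' K, QuotientGroup.continuous_mk⟩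
  have hkill : ∀ v : ℝ, 0 < v → ∀ σ ∈ absUpperInertia F v, f σ = 1 := by
    intro v hv σ hσ
    change QuotientGroup.mk' K σ = 1
    rw [QuotientGroup.mk'_apply, QuotientGroup.eq_one_iff]
    rcases le_total v v₁ with hle | hle
    · -- `π σ ∈ Pv v = Pv v₁`, so `σ ∈ J V`
      have hmem : π.toMonoidHom σ ∈ Pv v₁ := hstab v hv hle ▸ Subgroup.mem_map_of_mem _ hσ
      obtain ⟨y, hy, hyσ⟩ := Subgroup.mem_map.1 hmem
      have hyσ' : y⁻¹ * σ ∈ V := by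
        change QuotientGroup.mk' V y = QuotientGroup.mk' V σ at hyσ
        rwa [QuotientGroup.mk'_apply, QuotientGroup.mk'_apply, QuotientGroup.eq] at hyσ
      rw [show σ = y * (y⁻¹ * σ) by group]
      exact K.mul_mem (le_sup_left (b := V) hy) (hVK hyσ')
    · exact le_sup_left (b := V) (absUpperInertia_antitone_holds F hle hσ)
  obtain ⟨hcyc, -⟩ := absInertia_map_isCyclic_holds F (absoluteGaloisGroup F ⧸ K) f hkill
  -- Step 4: `W = K ∩ I` and a generator
  obtain ⟨c, hc⟩ := @IsCyclic.exists_generator _ _ hcyc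
  obtain ⟨g₀, hg₀, hg₀c⟩ := Subgroup.mem_map.1 c.2
  refine ⟨K.subgroupOf (absInertia F), ⟨g₀, hg₀⟩, fun x => ?_, fun φ hφ => ?_⟩
  · have hx : (⟨f.toMonoidHom x, Subgroup.mem_map_of_mem _ x.2⟩ : (absInertia F).map f.toMonoidHom) ∈
        Submonoid.powers c := by
      rw [(isOfFinOrder_of_finite c).mem_powers_iff_mem_zpowers]; exact hc _
    obtain ⟨k, hk⟩ := (Submonoid.mem_powers_iff _ _).1 hx
    refine ⟨k, ?_⟩
    have hk' : f.toMonoidHom (g₀ ^ k) = f.toMonoidHom x := by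
      have := congrArg Subtype.val hk
      rw [SubmonoidClass.coe_pow, ← hg₀c, ← map_pow] at this
      exact this
    rw [Subgroup.mem_subgroupOf, Subgroup.coe_mul, Subgroup.coe_inv, SubgroupClass.coe_pow]
    change QuotientGroup.mk' K (g₀ ^ k) = QuotientGroup.mk' K (x : absoluteGaloisGroup F) at hk'
    rwa [QuotientGroup.mk'_apply, QuotientGroup.mk'_apply, QuotientGroup.eq] at hk'
  · -- Step 5: averaging on `J = I^{v₁}`
    have hPJ : IsPGroup (ringChar 𝓀[F]) (J.map (QuotientGroup.mk' V)) :=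
      absUpperInertia_map_isPGroup_holds F (absoluteGaloisGroup F ⧸ V) π hv₁
    let ψ : J → B := fun y => φ.1 ⟨y, hJI y.2⟩
    obtain ⟨b, hb⟩ := exists_forall_eq_coboundary_of_isPGroup ρ hB J V hPJ ψ
      (fun x y => φ.2 ⟨x, hJI x.2⟩ ⟨y, hJI y.2⟩)
      (fun x y hy => hVinv φ hφ ⟨x, hJI x.2⟩ ⟨y, hJI y.2⟩ ((QuotientGroup.eq_one_iff _).1 hy))
    refine ⟨b, fun w hw => ?_⟩
    -- `w = y v` with `y ∈ J`, `v ∈ V`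
    have hw' : ((w : absoluteGaloisGroup F)) ∈ (↑(J ⊔ V) : Set (absoluteGaloisGroup F)) := hw
    rw [Subgroup.normal_mul] at hw'
    obtain ⟨y, hy, v, hv, hyv⟩ := Set.mem_mul.1 hw'
    have hvI : v ∈ absInertia F := by
      have : v = y⁻¹ * w := by rw [← hyv, inv_mul_cancel_left]
      rw [this]; exact (absInertia F).mul_mem ((absInertia F).inv_mem (hJI hy)) w.2
    have hwprod : w = ⟨y, hJI hy⟩ * ⟨v, hvI⟩ := Subtype.ext hyv.symm
    rw [hwprod, hVinv φ hφ _ _ hv]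
    change ψ ⟨y, hy⟩ = ρ (y * v) b - b
    rw [hb ⟨y, hy⟩, map_mul, Module.End.mul_apply, hVact v hv]

/-- **`#H¹(I_F, B) ≤ #B`** for a finite discrete `Γ_F`-module `B` of order prime to the residue
characteristic, and `H¹(I_F, B)` is finite (Harari, Lemma 10.13; Milne, ADT I Lemma 2.9;
Serre, CG II §5.5). [cite: MilneADT2006, I §2 Lemma 2.9] [cite: SerreLocalFields1979, IV §2 Cor. 1 and Cor. 3 of Prop. 7] -/
theorem natCard_continuousCohomology_one_absInertia_le (ρ : ContinuousRep (absoluteGaloisGroup F) ℤ B)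
    (hB : (Nat.card B).Coprime (ringChar 𝓀[F])) :
    Finite (continuousCohomology 1 ((ρ.restrict (subgroupIncl (absInertia F))).toTopRep)) ∧
    Nat.card (continuousCohomology 1 ((ρ.restrict (subgroupIncl (absInertia F))).toTopRep)) ≤ Nat.card B := by
  classical
  -- any finite set of classes has at most `#B` elements
  have key : ∀ T : Finset (continuousCohomology 1 ((ρ.restrict (subgroupIncl (absInertia F))).toTopRep)),
      T.card ≤ Nat.card B := by
    intro T
    haveI : Fintype B := Fintype.ofFinite B
    choose rep hrep using fun c : continuousCohomology 1 ((ρ.restrict (subgroupIncl (absInertia F))).toTopRep) =>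
      oneCocycleClass_surjective _ c
    obtain ⟨W, g, hgen, hcob⟩ := exists_subgroup_forall_eq_coboundary F ρ hB (T.image rep)
    choose b hb using fun (c : T) => hcob (rep c) (Finset.mem_image_of_mem rep c.2)
    -- the value at `g` of the normalised representative
    let val : T → B := fun c => (rep c).1 g - (ρ (g : absoluteGaloisGroup F) (b c) - b c)
    suffices hinj : Injective val by
      have := Fintype.card_le_of_injective val hinj
      rwa [Fintype.card_coe, ← Nat.card_eq_fintype_card] at this
    intro c d hcd
    apply Subtype.ext
    -- `D = rep c - rep d - ∂(b c - b d)` vanishes on `W` and at `g`, hence everywhere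
    let D : absInertia F → B := fun x =>
      (rep c).1 x - (rep d).1 x - (ρ (x : absoluteGaloisGroup F) (b c - b d) - (b c - b d))
    have hDdef : ∀ x, D x = (rep c).1 x - (rep d).1 x - (ρ (x : absoluteGaloisGroup F) (b c - b d) - (b c - b d)) :=
      fun _ => rfl
    have hD : ∀ x y, D (x * y) = D x + ρ (x : absoluteGaloisGroup F) (D y) := fun x y => by
      rw [hDdef, hDdef, hDdef, (rep c).2 x y, (rep d).2 x y]
      change (rep c).1 x + ρ (x : absoluteGaloisGroup F) ((rep c).1 y) -
          ((rep d).1 x + ρ (x : absoluteGaloisGroup F) ((rep d).1 y)) - _ = _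
      simp only [map_sub, Subgroup.coe_mul, map_mul, Module.End.mul_apply]
      abel
    have hDW : ∀ w ∈ W, D w = 0 := fun w hw => by
      rw [hDdef, hb c w hw, hb d w hw, map_sub]; abel
    have hDg : D g = 0 := by
      have := hcd
      change (rep c).1 g - (ρ (g : absoluteGaloisGroup F) (b c) - b c) =
        (rep d).1 g - (ρ (g : absoluteGaloisGroup F) (b d) - b d) at this
      have h' : (rep c).1 g - (ρ (g : absoluteGaloisGroup F) (b c) - b c) -
          ((rep d).1 g - (ρ (g : absoluteGaloisGroup F) (b d) - b d)) = 0 := sub_eq_zero.2 this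
      rw [hDdef, map_sub, ← h']
      abel
    have hD0 := eq_zero_of_forall_mem_of_apply_eq_zero (fun (x : absInertia F) (v : B) => ρ (x : absoluteGaloisGroup F) v)
      (fun x => map_zero _) W g hgen D hD hDW hDg
    have hcls : oneCocycleClass _ (rep c - rep d) = 0 := by
      rw [oneCocycleClass_eq_zero_iff]
      refine ⟨b c - b d, fun x => ?_⟩
      have := hD0 x
      rw [hDdef, sub_eq_zero] at this
      exact this
    rw [oneCocycleClass_sub, sub_eq_zero, hrep, hrep] at hcls
    exact hcls
  have hfin : Finite (continuousCohomology 1 ((ρ.restrict (subgroupIncl (absInertia F))).toTopRep)) := by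
    by_contra hinf
    rw [not_finite_iff_infinite] at hinf
    obtain ⟨T, hT⟩ := Infinite.exists_subset_card_eq
      (continuousCohomology 1 ((ρ.restrict (subgroupIncl (absInertia F))).toTopRep)) (Nat.card B + 1)
    have := key T
    omega
  haveI := hfin
  haveI := Fintype.ofFinite (continuousCohomology 1 ((ρ.restrict (subgroupIncl (absInertia F))).toTopRep))
  refine ⟨hfin, ?_⟩
  rw [Nat.card_eq_fintype_card, ← Finset.card_univ]
  exact key _

end Local

end Literature.NumberTheory.GaloisRepresentations

end
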